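/-
Copyright: the b2b-balaban T⁴-continuum CRUX team, row NE7b, leaf lineage `t4-ne7b-formalise-leaf-06` (gen 146). Project licence.
-/
import Summits.QuantumFields.BalabanUV.T4Continuum.Spine.NE7b.ConvexTiltMoment
import Literature.Analysis.FunctionSpaces.UniformlyConvexPoincare

/-!
# THE CONVEXITY ROAD WITHOUT DISPLAYED INTEGRABILITIES: under the first-order `λ`-convexity letter ALONE, `e^{−V}` is integrable
# and the linear functionals `⟪u, ·⟫` have tilted first and second moments — so `…ConvexTiltMoment`'s `hZ ∕ h1 ∕ h2` are
# consequences of `hV`, and the sacrificed exponential moment is bounded with data `(λ, V, q ≥ 0, u)` only (row NE7b, node U5c; [folklore])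

Cell `pub-balaban`, sub-cell `t4`, spine estimate NE7b (`T4WeightBudget.RelWeightBound`; the cell's OWN estimate — NOT PRINTED in
[Bałaban 1983–89], NOT PROVED).  Crux-route work under `Spine/NE7b/` (FREEZE (0) crux-prover clause): [folklore] real analysis over
Mathlib, the tree's `Literature.Analysis.FunctionSpaces.integrable_exp_neg_of_uniformlyConvex` and the OWNER's
`…NE7b.ConvexTiltMoment` BY NAME; NOTHING of Bałaban's is named, valued or asserted; no `T4Continuum/Support` leaf typed; no `def`;
zero `sorry`.

WHY.  The OWNER g106's `…ConvexTiltMoment.exp_moment_le_of_uniformlyConvex(_window)` (the convexity road T-60a′: one Jensen step +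
the tree's Brascamp–Lieb variance inequality) displays, besides the convexity letter `hV` and the (R1″)-class tilted means `m_k`,
THREE integrability binders: `hZ : e^{−V} ∈ L¹`, `h1 : ⟪u_k,·⟫ ∈ L¹(ν_V)`, `h2 : ⟪u_k,·⟫² ∈ L¹(ν_V)` («integrabilities displayed»;
chair X-CTM INFO-2).  All three FOLLOW from `hV` with `V` continuous: the first-order `λ`-convexity inequality at the single point
`x = 0` gives the GAUSSIAN LOWER BOUND `V y ≥ V 0 − ‖∇V 0‖²∕λ + (λ∕4)‖y‖²`, hence `e^{−V} ≤ e^{‖∇V 0‖²∕λ − V 0}·e^{−(λ∕4)‖y‖²}`, and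
polynomial moments of a Gaussian are finite.  This file proves that and re-issues the OWNER's two ENDs with the three binders
DISCHARGED — the road's data are then `(λ, V, q ≥ 0, u)` and, on a window, `(K, η, hmass)`; what stays displayed is exactly the
(R1″)-class letter (the tilted means `m_k`, the mass fraction `η`) and the convexity letter itself (Δ4).

WHAT IS PROVED ([folklore]):
* §1 GAUSSIAN LETTERS on `EuclideanSpace ℝ (Fin n)`: `integrable_exp_neg_mul_norm_sq` (`e^{−b‖x‖²} ∈ L¹`, `b > 0`),
  `norm_sq_mul_exp_neg_le` (`‖x‖²·e^{−b‖x‖²} ≤ (2∕b)·e^{−(b∕2)‖x‖²}`), `norm_le_one_add_norm_sq` (`‖x‖ ≤ 1 + ‖x‖²`).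
* §2 THE GAUSSIAN LOWER BOUND FROM THE CONVEXITY LETTER: **`exp_neg_le_gaussian_of_uniformlyConvex`**
  (`e^{−V y} ≤ e^{‖∇V 0‖²∕λ − V 0}·e^{−(λ∕4)‖y‖²}`), and the integrabilities **`integrable_inner_mul_exp_neg_of_uniformlyConvex`**,
  **`integrable_inner_sq_mul_exp_neg_of_uniformlyConvex`** (`⟪u,·⟫^k·e^{−V} ∈ L¹`, `k = 1, 2`), their TILTED forms
  **`integrable_inner_tilted_of_uniformlyConvex`**, **`integrable_inner_sq_tilted_of_uniformlyConvex`** (`⟪u,·⟫^k ∈ L¹(ν_V)`), with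
  `hZ` supplied by the tree's `integrable_exp_neg_of_uniformlyConvex`.
* §3 THE ENDS RE-ISSUED: **`exp_moment_le_of_uniformlyConvex'`** (`hlam`, `hVc`, `hV`, `q ≥ 0`, `u` ⊢ the OWNER's
  `∫e^{−V} ≤ exp(Σ_k q_k(λ⁻¹‖u_k‖² + m_k²))·∫e^{−(V+g)}`) and **`exp_moment_le_of_uniformlyConvex_window'`** (+ `K`, `η < 1`, `hmass` ⊢
  the windowed END) — the OWNER's theorems BY NAME with `hZ ∕ h1 ∕ h2` discharged by §2; and **`sq_moment_inner_le'`** likewise.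
NOT HERE (honest): the tilted means `m_k` ((R1″)-class), the mass fraction `η`, the convexity of Bałaban's small-field exponents on
their windows (Δ4) — (A1c) readings; the `EuclideanSpace ↔ (Fin n → ℝ)` transport; anything of Bałaban's.  BY-NAME EFFECT ON THE
WALL: NONE (three displayed [folklore] binders removed from one road).  NE7b NOT PRINTED ∕ NOT PROVED; spine PROVED 0∕9; rung (B)+1 on
ONE finite T⁴ — NOT infinite volume, NOT the mass gap, NOT Clay.
HONEST DEPENDENCY: continuum YM on T⁴ ⇐ BetaPertH ∧ nine spine estimates (0∕9 proved); BetaPertH ⇐ (D1) ∧ (D4) ∧ CAP+tail.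
-/

set_option autoImplicit false

noncomputable section

open MeasureTheory Real Finset
open scoped RealInnerProductSpace
open Literature.Analysis.FunctionSpaces (integrable_exp_neg_of_uniformlyConvex)
open Summit.QuantumFields.BalabanUV.T4Continuum.NE7b.ConvexTiltMoment

namespace Summit.QuantumFields.BalabanUV.T4Continuum.NE7b.UniformlyConvexTiltedMoments

variable {n : ℕ}

/-! ## §1 Gaussian letters on `EuclideanSpace ℝ (Fin n)` -/

/-- The real Gaussian `e^{−b‖x‖²}` (`b > 0`) is Lebesgue integrable on `ℝⁿ` (norm of Mathlib's complex Gaussian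
`GaussianFourier.integrable_cexp_neg_mul_sq_norm_add`). [folklore] -/
theorem integrable_exp_neg_mul_norm_sq {b : ℝ} (hb : 0 < b) : Integrable fun x : EuclideanSpace ℝ (Fin n) => exp (-b * ‖x‖ ^ 2) := by
  have h := (GaussianFourier.integrable_cexp_neg_mul_sq_norm_add (V := EuclideanSpace ℝ (Fin n)) (b := b) (by simpa using hb) 0 0).norm
  refine h.congr (Filter.Eventually.of_forall fun v => ?_)
  simp only [zero_mul, add_zero, Complex.norm_exp]
  congr 1
  have : -(b : ℂ) * (‖v‖ : ℂ) ^ 2 = ((-b * ‖v‖ ^ 2 : ℝ) : ℂ) := by push_cast; ring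
  rw [this, Complex.ofReal_re]

/-- `‖x‖²·e^{−b‖x‖²} ≤ (2∕b)·e^{−(b∕2)‖x‖²}` for `b > 0` (from `1 + t ≤ eᵗ` at `t = (b∕2)‖x‖²`). [folklore] -/
theorem norm_sq_mul_exp_neg_le {b : ℝ} (hb : 0 < b) (x : EuclideanSpace ℝ (Fin n)) :
    ‖x‖ ^ 2 * exp (-b * ‖x‖ ^ 2) ≤ 2 / b * exp (-(b / 2) * ‖x‖ ^ 2) := by
  have h1 := add_one_le_exp (b / 2 * ‖x‖ ^ 2)
  have h2 : ‖x‖ ^ 2 ≤ 2 / b * exp (b / 2 * ‖x‖ ^ 2) := by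
    rw [div_mul_eq_mul_div, le_div_iff₀ hb]
    nlinarith [exp_pos (b / 2 * ‖x‖ ^ 2), sq_nonneg ‖x‖]
  calc ‖x‖ ^ 2 * exp (-b * ‖x‖ ^ 2) ≤ 2 / b * exp (b / 2 * ‖x‖ ^ 2) * exp (-b * ‖x‖ ^ 2) :=
        mul_le_mul_of_nonneg_right h2 (exp_pos _).le
    _ = 2 / b * exp (-(b / 2) * ‖x‖ ^ 2) := by
        rw [mul_assoc, ← exp_add]; congr 1; congr 1; ring

omit n in
/-- `‖x‖ ≤ 1 + ‖x‖²`. [folklore] -/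
theorem norm_le_one_add_norm_sq {E : Type*} [SeminormedAddCommGroup E] (x : E) : ‖x‖ ≤ 1 + ‖x‖ ^ 2 := by
  nlinarith [sq_nonneg (‖x‖ - 1 / 2), norm_nonneg x]

/-! ## §2 The Gaussian lower bound from the convexity letter; tilted moments of linear functionals -/

/-- **THE GAUSSIAN BOUND FROM FIRST-ORDER `λ`-CONVEXITY AT ONE POINT**: `V 0 + ⟪∇V 0, y⟫ + (λ∕2)‖y‖² ≤ V y` and
`‖∇V 0‖·‖y‖ ≤ ‖∇V 0‖²∕λ + (λ∕4)‖y‖²` give `e^{−V y} ≤ e^{‖∇V 0‖²∕λ − V 0} · e^{−(λ∕4)‖y‖²}`. [folklore] -/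
theorem exp_neg_le_gaussian_of_uniformlyConvex {V : EuclideanSpace ℝ (Fin n) → ℝ} {lam : ℝ} (hlam : 0 < lam)
    (hV : ∀ x y : EuclideanSpace ℝ (Fin n), V x + ⟪gradient V x, y - x⟫ + lam / 2 * ‖y - x‖ ^ 2 ≤ V y) (y : EuclideanSpace ℝ (Fin n)) :
    exp (-V y) ≤ exp (‖gradient V 0‖ ^ 2 / lam - V 0) * exp (-(lam / 4) * ‖y‖ ^ 2) := by
  set a : ℝ := ‖gradient V 0‖ with ha
  have h1 := hV 0 y
  rw [sub_zero] at h1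
  have h2 : -(a * ‖y‖) ≤ ⟪gradient V 0, y⟫ := by
    have h := abs_real_inner_le_norm (gradient V 0) y
    have h' := neg_abs_le ⟪gradient V 0, y⟫
    linarith
  have h3 : a * ‖y‖ ≤ a ^ 2 / lam + lam / 4 * ‖y‖ ^ 2 := by
    have hsq : 0 ≤ lam * (a / lam - ‖y‖ / 2) ^ 2 := mul_nonneg hlam.le (sq_nonneg _)
    have e : a * ‖y‖ = a ^ 2 / lam + lam / 4 * ‖y‖ ^ 2 - lam * (a / lam - ‖y‖ / 2) ^ 2 := by
      field_simp
      ring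
    rw [e]
    linarith
  rw [← exp_add]
  exact exp_le_exp.2 (by linarith)

/-- `⟪u, ·⟫·e^{−V} ∈ L¹` under the convexity letter (`V` continuous). [folklore] -/
theorem integrable_inner_mul_exp_neg_of_uniformlyConvex {V : EuclideanSpace ℝ (Fin n) → ℝ} {lam : ℝ} (hlam : 0 < lam) (hVc : Continuous V)
    (hV : ∀ x y : EuclideanSpace ℝ (Fin n), V x + ⟪gradient V x, y - x⟫ + lam / 2 * ‖y - x‖ ^ 2 ≤ V y) (u : EuclideanSpace ℝ (Fin n)) :
    Integrable fun x : EuclideanSpace ℝ (Fin n) => exp (-V x) • ⟪u, x⟫ := by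
  set C : ℝ := exp (‖gradient V 0‖ ^ 2 / lam - V 0) with hC
  have hC0 : 0 ≤ C := (exp_pos _).le
  have hl4 : 0 < lam / 4 := by positivity
  have hG4 := integrable_exp_neg_mul_norm_sq (n := n) hl4
  have hG8 : Integrable fun x : EuclideanSpace ℝ (Fin n) => exp (-(lam / 4 / 2) * ‖x‖ ^ 2) :=
    integrable_exp_neg_mul_norm_sq (n := n) (by positivity)
  have hmeas : AEStronglyMeasurable (fun x : EuclideanSpace ℝ (Fin n) => exp (-V x) • ⟪u, x⟫) volume :=
    (hVc.neg.rexp.smul (continuous_const.inner continuous_id)).aestronglyMeasurable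
  refine (((hG4.add (hG8.const_mul (2 / (lam / 4)))).const_mul (C * ‖u‖))).mono' hmeas
    (Filter.Eventually.of_forall fun x => ?_)
  rw [smul_eq_mul, norm_mul, Real.norm_of_nonneg (exp_pos _).le, Real.norm_eq_abs]
  have hin : |⟪u, x⟫| ≤ ‖u‖ * ‖x‖ := abs_real_inner_le_norm u x
  have hx : ‖x‖ ≤ 1 + ‖x‖ ^ 2 := norm_le_one_add_norm_sq x
  have hdom := exp_neg_le_gaussian_of_uniformlyConvex hlam hV x
  have hsq := norm_sq_mul_exp_neg_le (n := n) hl4 x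
  simp only [Pi.add_apply]
  calc exp (-V x) * |⟪u, x⟫| ≤ (C * exp (-(lam / 4) * ‖x‖ ^ 2)) * (‖u‖ * (1 + ‖x‖ ^ 2)) :=
        mul_le_mul hdom (hin.trans (mul_le_mul_of_nonneg_left hx (norm_nonneg _))) (abs_nonneg _)
          (mul_nonneg hC0 (exp_pos _).le)
    _ = C * ‖u‖ * (exp (-(lam / 4) * ‖x‖ ^ 2) + ‖x‖ ^ 2 * exp (-(lam / 4) * ‖x‖ ^ 2)) := by ring
    _ ≤ C * ‖u‖ * (exp (-(lam / 4) * ‖x‖ ^ 2) + 2 / (lam / 4) * exp (-(lam / 4 / 2) * ‖x‖ ^ 2)) := by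
        have := mul_nonneg hC0 (norm_nonneg u)
        nlinarith [hsq]

/-- `⟪u, ·⟫²·e^{−V} ∈ L¹` under the convexity letter (`V` continuous). [folklore] -/
theorem integrable_inner_sq_mul_exp_neg_of_uniformlyConvex {V : EuclideanSpace ℝ (Fin n) → ℝ} {lam : ℝ} (hlam : 0 < lam) (hVc : Continuous V)
    (hV : ∀ x y : EuclideanSpace ℝ (Fin n), V x + ⟪gradient V x, y - x⟫ + lam / 2 * ‖y - x‖ ^ 2 ≤ V y) (u : EuclideanSpace ℝ (Fin n)) :
    Integrable fun x : EuclideanSpace ℝ (Fin n) => exp (-V x) • ⟪u, x⟫ ^ 2 := by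
  set C : ℝ := exp (‖gradient V 0‖ ^ 2 / lam - V 0) with hC
  have hC0 : 0 ≤ C := (exp_pos _).le
  have hl4 : 0 < lam / 4 := by positivity
  have hG8 : Integrable fun x : EuclideanSpace ℝ (Fin n) => exp (-(lam / 4 / 2) * ‖x‖ ^ 2) :=
    integrable_exp_neg_mul_norm_sq (n := n) (by positivity)
  have hmeas : AEStronglyMeasurable (fun x : EuclideanSpace ℝ (Fin n) => exp (-V x) • ⟪u, x⟫ ^ 2) volume :=
    (hVc.neg.rexp.smul ((continuous_const.inner continuous_id).pow 2)).aestronglyMeasurable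
  refine ((hG8.const_mul (C * ‖u‖ ^ 2 * (2 / (lam / 4))))).mono' hmeas (Filter.Eventually.of_forall fun x => ?_)
  rw [smul_eq_mul, norm_mul, Real.norm_of_nonneg (exp_pos _).le, norm_pow, Real.norm_eq_abs]
  have hin : |⟪u, x⟫| ≤ ‖u‖ * ‖x‖ := abs_real_inner_le_norm u x
  have hin2 : |⟪u, x⟫| ^ 2 ≤ (‖u‖ * ‖x‖) ^ 2 := pow_le_pow_left₀ (abs_nonneg _) hin 2
  have hdom := exp_neg_le_gaussian_of_uniformlyConvex hlam hV x
  have hsq := norm_sq_mul_exp_neg_le (n := n) hl4 x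
  calc exp (-V x) * |⟪u, x⟫| ^ 2 ≤ (C * exp (-(lam / 4) * ‖x‖ ^ 2)) * (‖u‖ * ‖x‖) ^ 2 :=
        mul_le_mul hdom hin2 (pow_nonneg (abs_nonneg _) 2) (mul_nonneg hC0 (exp_pos _).le)
    _ = C * ‖u‖ ^ 2 * (‖x‖ ^ 2 * exp (-(lam / 4) * ‖x‖ ^ 2)) := by ring
    _ ≤ C * ‖u‖ ^ 2 * (2 / (lam / 4) * exp (-(lam / 4 / 2) * ‖x‖ ^ 2)) :=
        mul_le_mul_of_nonneg_left hsq (mul_nonneg hC0 (sq_nonneg _))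
    _ = C * ‖u‖ ^ 2 * (2 / (lam / 4)) * exp (-(lam / 4 / 2) * ‖x‖ ^ 2) := by ring

/-- **TILTED FIRST MOMENT**: `⟪u, ·⟫ ∈ L¹(ν_V)`, `ν_V = e^{−V}dx ∕ ∫e^{−V}`, under the convexity letter. [folklore] -/
theorem integrable_inner_tilted_of_uniformlyConvex {V : EuclideanSpace ℝ (Fin n) → ℝ} {lam : ℝ} (hlam : 0 < lam) (hVc : Continuous V)
    (hV : ∀ x y : EuclideanSpace ℝ (Fin n), V x + ⟪gradient V x, y - x⟫ + lam / 2 * ‖y - x‖ ^ 2 ≤ V y) (u : EuclideanSpace ℝ (Fin n)) :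
    Integrable (fun x : EuclideanSpace ℝ (Fin n) => ⟪u, x⟫) (volume.tilted fun x => -V x) :=
  (integrable_tilted_iff (integrable_exp_neg_of_uniformlyConvex hlam hVc hV) _).2
    (integrable_inner_mul_exp_neg_of_uniformlyConvex hlam hVc hV u)

/-- **TILTED SECOND MOMENT**: `⟪u, ·⟫² ∈ L¹(ν_V)` under the convexity letter. [folklore] -/
theorem integrable_inner_sq_tilted_of_uniformlyConvex {V : EuclideanSpace ℝ (Fin n) → ℝ} {lam : ℝ} (hlam : 0 < lam) (hVc : Continuous V)
    (hV : ∀ x y : EuclideanSpace ℝ (Fin n), V x + ⟪gradient V x, y - x⟫ + lam / 2 * ‖y - x‖ ^ 2 ≤ V y) (u : EuclideanSpace ℝ (Fin n)) :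
    Integrable (fun x : EuclideanSpace ℝ (Fin n) => ⟪u, x⟫ ^ 2) (volume.tilted fun x => -V x) :=
  (integrable_tilted_iff (integrable_exp_neg_of_uniformlyConvex hlam hVc hV) _).2
    (integrable_inner_sq_mul_exp_neg_of_uniformlyConvex hlam hVc hV u)

/-! ## §3 The OWNER's ENDs re-issued with the integrabilities discharged -/

/-- `…ConvexTiltMoment.sq_moment_inner_le` with `hZ ∕ h1 ∕ h2` DISCHARGED: `∫⟪u,x⟫² dν_V ≤ λ⁻¹‖u‖² + (∫⟪u,x⟫dν_V)²` from the
convexity letter alone. [folklore] -/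
theorem sq_moment_inner_le' {V : EuclideanSpace ℝ (Fin n) → ℝ} {lam : ℝ} (hlam : 0 < lam) (hVc : Continuous V)
    (hV : ∀ x y : EuclideanSpace ℝ (Fin n), V x + ⟪gradient V x, y - x⟫ + lam / 2 * ‖y - x‖ ^ 2 ≤ V y) (u : EuclideanSpace ℝ (Fin n)) :
    ∫ x, ⟪u, x⟫ ^ 2 ∂(volume.tilted fun x => -V x) ≤
      lam⁻¹ * ‖u‖ ^ 2 + (∫ x, ⟪u, x⟫ ∂(volume.tilted fun x => -V x)) ^ 2 :=
  sq_moment_inner_le hlam hVc hV (integrable_exp_neg_of_uniformlyConvex hlam hVc hV) u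
    (integrable_inner_tilted_of_uniformlyConvex hlam hVc hV u) (integrable_inner_sq_tilted_of_uniformlyConvex hlam hVc hV u)

/-- **THE CONVEXITY ROAD WITH DATA `(λ, V, q ≥ 0, u)` ONLY** = the OWNER's `…ConvexTiltMoment.exp_moment_le_of_uniformlyConvex` BY NAME
with `hZ ∕ h1 ∕ h2` DISCHARGED by §2: `∫e^{−V} ≤ exp(Σ_k q_k·(λ⁻¹‖u_k‖² + m_k²))·∫e^{−(V+g)}`, `m_k = ∫⟪u_k,x⟫dν_V`. [folklore] -/
theorem exp_moment_le_of_uniformlyConvex' {V : EuclideanSpace ℝ (Fin n) → ℝ} {lam : ℝ} {r : ℕ} (hlam : 0 < lam) (hVc : Continuous V)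
    (hV : ∀ x y : EuclideanSpace ℝ (Fin n), V x + ⟪gradient V x, y - x⟫ + lam / 2 * ‖y - x‖ ^ 2 ≤ V y)
    (q : Fin r → ℝ) (hq : ∀ k, 0 ≤ q k) (u : Fin r → EuclideanSpace ℝ (Fin n)) :
    ∫ x, exp (-V x) ≤
      exp (∑ k, q k * (lam⁻¹ * ‖u k‖ ^ 2 + (∫ x, ⟪u k, x⟫ ∂(volume.tilted fun x => -V x)) ^ 2)) *
        ∫ x, exp (-(V x + ∑ k, q k * ⟪u k, x⟫ ^ 2)) :=
  exp_moment_le_of_uniformlyConvex hlam hVc hV (integrable_exp_neg_of_uniformlyConvex hlam hVc hV) q hq u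
    (fun k => integrable_inner_tilted_of_uniformlyConvex hlam hVc hV (u k))
    (fun k => integrable_inner_sq_tilted_of_uniformlyConvex hlam hVc hV (u k))

/-- **THE CONVEXITY ROAD ON A WINDOW WITH DATA `(λ, V, q ≥ 0, u; K, η, hmass)` ONLY** = the OWNER's
`…ConvexTiltMoment.exp_moment_le_of_uniformlyConvex_window` BY NAME with `hZ ∕ h1 ∕ h2` DISCHARGED by §2. [folklore] -/
theorem exp_moment_le_of_uniformlyConvex_window' {V : EuclideanSpace ℝ (Fin n) → ℝ} {lam η : ℝ} {r : ℕ} (hlam : 0 < lam) (hVc : Continuous V)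
    (hV : ∀ x y : EuclideanSpace ℝ (Fin n), V x + ⟪gradient V x, y - x⟫ + lam / 2 * ‖y - x‖ ^ 2 ≤ V y)
    (q : Fin r → ℝ) (hq : ∀ k, 0 ≤ q k) (u : Fin r → EuclideanSpace ℝ (Fin n)) (K : Set (EuclideanSpace ℝ (Fin n))) (hη : η < 1)
    (hmass : (1 - η) * ∫ x, exp (-V x) ≤ ∫ x in K, exp (-V x)) :
    ∫ x in K, exp (-V x) ≤
      exp ((∑ k, q k * (lam⁻¹ * ‖u k‖ ^ 2 + (∫ x, ⟪u k, x⟫ ∂(volume.tilted fun x => -V x)) ^ 2)) / (1 - η)) *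
        ∫ x in K, exp (-(V x + ∑ k, q k * ⟪u k, x⟫ ^ 2)) :=
  exp_moment_le_of_uniformlyConvex_window hlam hVc hV (integrable_exp_neg_of_uniformlyConvex hlam hVc hV) q hq u
    (fun k => integrable_inner_tilted_of_uniformlyConvex hlam hVc hV (u k))
    (fun k => integrable_inner_sq_tilted_of_uniformlyConvex hlam hVc hV (u k)) K hη hmass

/-- Toy (non-vacuity of §3's data): the road at the standard Gaussian `V = ½‖x‖²` (`λ = 1`, equality in the convexity letter via
`∇(½‖·‖²) = id`), any dimension, any mode `u`, `q = 1` — no integrability supplied by hand. -/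
example (u : EuclideanSpace ℝ (Fin n)) :
    ∫ x : EuclideanSpace ℝ (Fin n), exp (-(1 / 2 * ‖x‖ ^ 2)) ≤
      exp (∑ k : Fin 1, (fun _ : Fin 1 => (1 : ℝ)) k *
          ((1 : ℝ)⁻¹ * ‖(fun _ : Fin 1 => u) k‖ ^ 2 +
            (∫ x, ⟪(fun _ : Fin 1 => u) k, x⟫ ∂(volume.tilted fun x : EuclideanSpace ℝ (Fin n) => -(1 / 2 * ‖x‖ ^ 2))) ^ 2)) *
        ∫ x : EuclideanSpace ℝ (Fin n), exp (-(1 / 2 * ‖x‖ ^ 2 + ∑ k : Fin 1, (fun _ : Fin 1 => (1 : ℝ)) k * ⟪(fun _ : Fin 1 => u) k, x⟫ ^ 2)) := by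
  have hgrad : ∀ x : EuclideanSpace ℝ (Fin n), gradient (fun y : EuclideanSpace ℝ (Fin n) => 1 / 2 * ‖y‖ ^ 2) x = x := fun x => by
    refine HasGradientAt.gradient ?_
    rw [hasGradientAt_iff_hasFDerivAt]
    refine (((hasStrictFDerivAt_norm_sq x).hasFDerivAt).const_mul (1 / 2 : ℝ)).congr_fderiv ?_
    ext v
    simp [InnerProductSpace.toDual_apply_apply, two_smul]
    ring
  refine exp_moment_le_of_uniformlyConvex' (V := fun x : EuclideanSpace ℝ (Fin n) => 1 / 2 * ‖x‖ ^ 2) one_pos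
    (continuous_const.mul (continuous_norm.pow 2)) (fun x y => ?_) (fun _ => (1 : ℝ)) (fun _ => zero_le_one) fun _ => u
  rw [hgrad, inner_sub_right, real_inner_self_eq_norm_sq, norm_sub_sq_real, real_inner_comm x y]
  linarith

end Summit.QuantumFields.BalabanUV.T4Continuum.NE7b.UniformlyConvexTiltedMoments

end
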